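import Mathlib

/-!
# Crux `DivisionGap.PerCofactorDegreeReduction` (stmt-ValiantsHypothesis-15046), line `Sketch` —
# stub `stub_contentSplit`: splitting off the monomial content of a cofactor

**Theorem (`stub_contentSplit`).** Every nonzero `h ∈ ℝ≥0[x_ij]` (`n × n` variables) factors as
`h = x^M · h₂` where `h₂` is CONTENT-FREE (every variable `v` is missed by some monomial of `h₂`)
and every monomial of `h₂` is `m - M` for a monomial `m ≥ M` of `h` (so `supp h₂ = supp h - M`
and `h₂` inherits single-typedness and homogeneity from `h`).

## Proof (pure algebra: any commutative semiring, any set of variables)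

`M := inf (supp h)` in the pointwise lattice `σ →₀ ℕ` (the GCD MONOMIAL of the nonempty support,
`M v = min_{m ∈ supp h} m v`): `M ≤ m` for every `m ∈ supp h` (`Finset.inf'_le`), and for every
variable `v` the minimum is attained at some `m_v ∈ supp h` (`Finset.exists_mem_eq_inf'` after
evaluating at `v`, `Finset.apply_inf'_eq_inf'_comp`).  Take `h₂ := h /ᵐ x^M`
(`MvPolynomial.divMonomial`, `coeff x h₂ = coeff (M + x) h`).
1. `x^M · (h /ᵐ x^M) + h %ᵐ x^M = h` (`MvPolynomial.divMonomial_add_modMonomial`) and the remainder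
   vanishes: its coefficient at `s` is `0` if `M ≤ s`, and `coeff s h = 0` otherwise (`s ∉ supp h`).
2. `x := m_v - M` has `x v = 0` and `coeff x h₂ = coeff (M + (m_v - M)) h = coeff m_v h ≠ 0`.
3. `x ∈ supp h₂` gives `M + x ∈ supp h`, `M ≤ M + x` and `x = (M + x) - M`.

Leans on Mathlib only.  No definitions.
-/

noncomputable section

-- `Summit.ValiantsHypothesis.ValiantsHypothesis.…` is the tree's mandated single-conjunct layout
-- (Problem = Summit), so the duplicated namespace component is intended.
set_option linter.dupNamespace false

namespace Summit.ValiantsHypothesis.ValiantsHypothesis.Theorems.DivisionGap.PerCofactorDegreeReduction.ContentSplit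

open MvPolynomial
open scoped NNReal

/-! ### The gcd monomial of a support and exact division by it -/

section General

variable {σ : Type*} {R : Type*} [CommSemiring R]

/-- The GCD MONOMIAL of the support of a nonzero polynomial: some `M` lies below every monomial of
`h` and, in each variable `v`, agrees with some monomial of `h` (take the infimum of the nonempty
support in the pointwise lattice `σ →₀ ℕ`). [folklore] -/
theorem exists_gcd_monomial (h : MvPolynomial σ R) (hh : h ≠ 0) :
    ∃ M : σ →₀ ℕ, (∀ m ∈ h.support, M ≤ m) ∧ ∀ v : σ, ∃ m ∈ h.support, m v = M v := by
  have hne : h.support.Nonempty := support_nonempty.2 hh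
  refine ⟨h.support.inf' hne id, fun m hm => Finset.inf'_le id hm, fun v => ?_⟩
  obtain ⟨m, hm, hmv⟩ := Finset.exists_mem_eq_inf' hne fun m : σ →₀ ℕ => m v
  have key : (h.support.inf' hne id) v = h.support.inf' hne fun m : σ →₀ ℕ => m v :=
    Finset.apply_inf'_eq_inf'_comp hne (fun f : σ →₀ ℕ => f v) fun f g => Finsupp.inf_apply f g v
  exact ⟨m, hm, by rw [key, hmv]⟩

/-- If `M` lies below every monomial of `h` then the remainder of `h` upon division by `x^M`
vanishes. [folklore] -/
theorem modMonomial_eq_zero_of_le (h : MvPolynomial σ R) {M : σ →₀ ℕ}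
    (hM : ∀ m ∈ h.support, M ≤ m) : h.modMonomial M = 0 := by
  ext s
  rw [coeff_zero]
  by_cases hs : M ≤ s
  · exact coeff_modMonomial_of_le h hs
  · rw [coeff_modMonomial_of_not_le h hs]
    exact notMem_support_iff.1 fun hs' => hs (hM s hs')

/-- If `M` lies below every monomial of `h` then `x^M` divides `h` exactly:
`x^M · (h /ᵐ x^M) = h`. [folklore] -/
theorem monomial_mul_divMonomial_of_le (h : MvPolynomial σ R) {M : σ →₀ ℕ}
    (hM : ∀ m ∈ h.support, M ≤ m) : monomial M 1 * h.divMonomial M = h := by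
  calc monomial M 1 * h.divMonomial M
      = monomial M 1 * h.divMonomial M + h.modMonomial M := by
        rw [modMonomial_eq_zero_of_le h hM, add_zero]
    _ = h := divMonomial_add_modMonomial h M

/-- **Content split, general form.**  Every nonzero polynomial over a commutative semiring is
`x^M · h₂` with `h₂ := h /ᵐ x^M` content-free (every variable is missed by some monomial of `h₂`)
and every monomial of `h₂` of the form `m - M`, `M ≤ m ∈ supp h`. [folklore] -/
theorem exists_content_split (h : MvPolynomial σ R) (hh : h ≠ 0) :
    ∃ (M : σ →₀ ℕ) (h₂ : MvPolynomial σ R),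
      monomial M 1 * h₂ = h ∧
      (∀ v : σ, ∃ m ∈ h₂.support, m v = 0) ∧
      (∀ x ∈ h₂.support, ∃ m ∈ h.support, M ≤ m ∧ x = m - M) := by
  obtain ⟨M, hM, hattained⟩ := exists_gcd_monomial h hh
  refine ⟨M, h.divMonomial M, monomial_mul_divMonomial_of_le h hM, fun v => ?_, fun x hx => ?_⟩
  · obtain ⟨m, hm, hmv⟩ := hattained v
    refine ⟨m - M, ?_, ?_⟩
    · rw [mem_support_iff, coeff_divMonomial, add_tsub_cancel_of_le (hM m hm)]
      exact mem_support_iff.1 hm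
    · rw [Finsupp.tsub_apply, hmv, tsub_self]
  · have hx' : coeff (M + x) h ≠ 0 := by
      rw [← coeff_divMonomial]
      exact mem_support_iff.1 hx
    exact ⟨M + x, mem_support_iff.2 hx', le_self_add, by rw [add_tsub_cancel_left]⟩

end General

/-! ### The stub -/

/-- **stub_contentSplit — SPLITTING OFF THE MONOMIAL CONTENT.**  Every nonzero `h ∈ ℝ≥0[x]`
(`n × n` variables) is `x^M · h₂` with `h₂` CONTENT-FREE (every variable is missed by some
monomial of `h₂`) and `supp h₂ = supp h - M` (every monomial of `h₂` is `m - M` for some monomial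
`m ≥ M` of `h`): `M := inf (supp h)` is the gcd monomial of the support and `h₂ := h /ᵐ x^M`
(`exists_content_split`). [folklore] -/
theorem stub_contentSplit (n : ℕ) (h : MvPolynomial (Fin n × Fin n) ℝ≥0) (hh : h ≠ 0) :
    ∃ (M : (Fin n × Fin n) →₀ ℕ) (h₂ : MvPolynomial (Fin n × Fin n) ℝ≥0),
      monomial M 1 * h₂ = h ∧
      (∀ v : Fin n × Fin n, ∃ m ∈ h₂.support, m v = 0) ∧
      (∀ x ∈ h₂.support, ∃ m ∈ h.support, M ≤ m ∧ x = m - M) :=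
  exists_content_split h hh

end Summit.ValiantsHypothesis.ValiantsHypothesis.Theorems.DivisionGap.PerCofactorDegreeReduction.ContentSplit

end
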